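import Literature.Computability.Complexity.PerfectMatchingColorings
import HarnessLib

/-!
# Razborov's lattice for the logical permanent: the negative error (Jukna 2012, Lemmas 9.36–9.37)

Continuation of `PerfectMatchingColorings.lean` (the colourings `E₋(h)`, fresh blocks and the
bound `#{h : ∀ t, D_t ⊄ E₋(h)} · (2ˢ)^q ≤ (2ˢ - 1)^q · 4^m` along a fresh sequence). PROVED here:

* `exists_fresh_cons`, `exists_fresh_list` — **Lemma 9.36 in constructive order**: among `r`
  pairwise disjoint nonempty matchings with `≤ s` edges there is a fresh sequence consisting of
  `q` of them whenever `(s q)² ≤ r` (Jukna: "`|ℱ₀| ≥ √r / s` matchings such that `∪ℱ₀` is a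
  forest"; the greedy step is his: fewer than `r` edges join two covered vertices, and the
  matchings are disjoint, so one of them avoids all such edges).
* `card_stepErr_mul_le` — inequality (9.8) of the proof of Lemma 9.37: one closure step
  `𝒜 ↦ 𝒜 ∪ {E₀}`, `𝒜 ⊢ E₀`, wrongly accepts at most a `(1 - 2^{-s})^q` fraction of the
  colourings.
* `card_negErr_le`, `sum_gainedSup_le` — **Lemma 9.37**: an approximate join of the scheme
  `PerfectMatching.scheme` wrongly accepts at most `|Per_s| · ⌊(2ˢ-1)^q 4^m/(2ˢ)^q⌋` colourings
  (via the closure-step skeleton `Razborov.card_filter_closureIn_gain_le`).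
* `card_filter_subset_colorGraph_mul` — a single matching `E` is monochromatic for exactly
  `4^m / 2^{|E|}` colourings (Lemma 9.35, used in Case 2 of Thm. 9.38).

## References

* S. Jukna, *Boolean Function Complexity: Advances and Frontiers*, Springer (2012), §9.11.2,
  Lemmas 9.35, 9.36, 9.37 and inequality (9.8) (PDF pp. 293–295) [Jukna2012].
* A. A. Razborov, *Lower bounds on monotone complexity of the logical permanent*, Mat. Zametki
  37 (1985) 887–900 [Razborov1985b].
-/

namespace Literature.Computability.Complexity

namespace PerfectMatching

open Finset Razborov

variable {m : ℕ}

/-! ### Selecting a fresh sequence (Jukna 2012, Lemma 9.36) -/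

/-- **The greedy step of Lemma 9.36.** Given `r` pairwise disjoint nonempty matchings `W_i`
with at most `s` edges and a fresh sequence `Ds` of `n` of them with `(s n)² < r`: the edges of
`Ds` cover at most `s n` left and `s n` right vertices, so fewer than `r` edges join two covered
vertices; by disjointness fewer than `r` of the `W_i` contain such an edge, and any other `W_i`
is fresh with respect to `Ds` (Jukna: "at least one of these matchings must have no edge in
`U₀ × V₀`"). [cite: Jukna2012, Lemma 9.36] -/
theorem exists_fresh_cons {r s : ℕ} (W : Fin r → Finset (Edge m))
    (hW : ∀ i, (W i).Nonempty ∧ #(W i) ≤ s) (hdisj : ∀ i j, i ≠ j → Disjoint (W i) (W j))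
    (Ds : List (Finset (Edge m))) (hDs : ∀ D ∈ Ds, #D ≤ s) (hlen : (s * Ds.length) ^ 2 < r)
    (hF : Fresh Ds) : ∃ i, Fresh (W i :: Ds) := by
  classical
  set E := edgesL Ds with hE
  set L : Finset (Fin m) := E.image Prod.fst with hL
  set R : Finset (Fin m) := E.image Prod.snd with hR
  have hEcard : #E ≤ s * Ds.length := card_edgesL_le hDs
  have hLcard : #L ≤ s * Ds.length := card_image_le.trans hEcard
  have hRcard : #R ≤ s * Ds.length := card_image_le.trans hEcard
  -- the matchings with an edge joining two covered vertices
  set Bad : Finset (Fin r) := univ.filter fun i => ∃ e ∈ W i, e ∈ L ×ˢ R with hBad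
  have hr0 : 0 < r := lt_of_le_of_lt (Nat.zero_le _) hlen
  obtain ⟨e₀, -⟩ := (hW ⟨0, hr0⟩).1
  have hBadcard : #Bad ≤ #(L ×ˢ R) := by
    let g : Fin r → Edge m := fun i => if h : ∃ e ∈ W i, e ∈ L ×ˢ R then h.choose else e₀
    have hg : ∀ i ∈ Bad, g i ∈ W i ∧ g i ∈ L ×ˢ R := by
      intro i hi
      have h := (mem_filter.1 hi).2
      simp only [g, dif_pos h]
      exact h.choose_spec
    refine card_le_card_of_injOn g (fun i hi => mem_coe.2 (hg i (mem_coe.1 hi)).2) ?_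
    intro i hi j hj hij
    by_contra hne
    have h1 := (hg i (mem_coe.1 hi)).1
    have h2 := (hg j (mem_coe.1 hj)).1
    rw [hij] at h1
    exact disjoint_left.1 (hdisj i j hne) h1 h2
  have hlt : #Bad < #(univ : Finset (Fin r)) := by
    rw [card_univ, Fintype.card_fin]
    calc #Bad ≤ #(L ×ˢ R) := hBadcard
      _ = #L * #R := card_product L R
      _ ≤ (s * Ds.length) * (s * Ds.length) := Nat.mul_le_mul hLcard hRcard
      _ = (s * Ds.length) ^ 2 := (sq _).symm
      _ < r := hlen
  obtain ⟨i, -, hi⟩ := exists_mem_notMem_of_card_lt_card hlt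
  refine ⟨i, hF, fun e he => ?_⟩
  have hno : ¬ (e ∈ L ×ˢ R) := fun hmem => hi (mem_filter.2 ⟨mem_univ _, e, he, hmem⟩)
  rw [mem_product, not_and_or] at hno
  rcases hno with h | h
  · left
    intro hmem
    obtain ⟨e', he', hee'⟩ := inl_mem_everts.1 hmem
    exact h (mem_image.2 ⟨e', he', hee'⟩)
  · right
    intro hmem
    obtain ⟨e', he', hee'⟩ := inr_mem_everts.1 hmem
    exact h (mem_image.2 ⟨e', he', hee'⟩)

/-- **Jukna 2012, Lemma 9.36, as a fresh sequence**: among `r` pairwise disjoint nonempty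
matchings with at most `s` edges each (`s ≥ 1`) there is a fresh sequence consisting of `q` of
them whenever `(s q)² ≤ r` (Jukna: "a subset `ℱ₀ ⊆ ℱ` of `|ℱ₀| ≥ √r/s` matchings such that `∪ℱ₀`
is a forest"). [cite: Jukna2012, Lemma 9.36] -/
theorem exists_fresh_list {r s q : ℕ} (W : Fin r → Finset (Edge m))
    (hW : ∀ i, (W i).Nonempty ∧ #(W i) ≤ s) (hdisj : ∀ i j, i ≠ j → Disjoint (W i) (W j))
    (hs : 0 < s) (hqr : (s * q) ^ 2 ≤ r) :
    ∀ n ≤ q, ∃ Ds : List (Finset (Edge m)), Ds.length = n ∧ Fresh Ds ∧ ∀ D ∈ Ds, ∃ i, D = W i := by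
  intro n
  induction n with
  | zero =>
    intro _
    exact ⟨[], rfl, trivial, fun D hD => by simp at hD⟩
  | succ n ih =>
    intro hn
    obtain ⟨Ds, hlen, hF, hmem⟩ := ih (Nat.le_of_succ_le hn)
    have hDs : ∀ D ∈ Ds, #D ≤ s := fun D hD => by
      obtain ⟨i, rfl⟩ := hmem D hD
      exact (hW i).2
    have hlt : (s * Ds.length) ^ 2 < r := by
      rw [hlen]
      have h1 : s * n < s * q := Nat.mul_lt_mul_of_pos_left (Nat.lt_of_succ_le hn) hs
      calc (s * n) ^ 2 < (s * q) ^ 2 := Nat.pow_lt_pow_left h1 two_ne_zero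
        _ ≤ r := hqr
    obtain ⟨i, hFi⟩ := exists_fresh_cons W hW hdisj Ds hDs hlt hF
    refine ⟨W i :: Ds, by rw [List.length_cons, hlen], hFi, fun D hD => ?_⟩
    rcases List.mem_cons.1 hD with rfl | hD
    · exact ⟨i, rfl⟩
    · exact hmem D hD

/-! ### The negative error of a closure step and of a join (Jukna 2012, (9.8) and Lemma 9.37) -/

/-- **Inequality (9.8) of Jukna 2012** (proof of Lemma 9.37), counting form: if
`E₁, …, E_r ∈ Per_s` imply `E₀` (`E_i ∩ E_j ⊆ E₀` for `i ≠ j`), the colourings `h` with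
`E₀ ⊆ E₋(h)` but `E_i ⊄ E₋(h)` for all `i` number at most `(1 - 2^{-s})^q · 4^m` whenever
`(s q)² ≤ r`: the sets `E_i ∖ E₀` are pairwise disjoint matchings; if one is empty there is no
such `h`; otherwise a fresh sequence of `q` of them (Lemma 9.36) is avoided by `E₋(h)`, which
happens for at most a `(1 - 2^{-s})^q` fraction of the colourings (Lemma 9.35).
[cite: Jukna2012, Lemma 9.37, inequality (9.8)] -/
theorem card_stepErr_mul_le {r s q : ℕ} (hs : 0 < s) (hqr : (s * q) ^ 2 ≤ r) {U : Finset (Edge m)}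
    (W : Fin r → Finset (Edge m)) (hW : ∀ i, W i ∈ Per m s) (hWU : ∀ i j, i ≠ j → W i ∩ W j ⊆ U) :
    #(univ.filter fun h : Vtx m → Bool => U ⊆ colorGraph h ∧ ∀ i, ¬ W i ⊆ colorGraph h) * (2 ^ s) ^ q ≤
      (2 ^ s - 1) ^ q * 4 ^ m := by
  classical
  -- the petals
  set D : Fin r → Finset (Edge m) := fun i => W i \ U with hDdef
  by_cases hempty : ∃ i, D i = ∅
  · obtain ⟨i, hi⟩ := hempty
    have hWi : W i ⊆ U := by
      intro e he
      by_contra heU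
      have : e ∈ D i := mem_sdiff.2 ⟨he, heU⟩
      rw [hi] at this
      exact notMem_empty e this
    rw [filter_false_of_mem, card_empty, zero_mul]
    · exact Nat.zero_le _
    · intro h _ hh
      exact hh.2 i (hWi.trans hh.1)
  have hD : ∀ i, (D i).Nonempty ∧ #(D i) ≤ s := fun i =>
    ⟨nonempty_iff_ne_empty.2 fun h => hempty ⟨i, h⟩,
      (card_le_card sdiff_subset).trans (mem_Per.1 (hW i)).2⟩
  have hDmatch : ∀ i, IsMatching (D i) := fun i => (mem_Per.1 (hW i)).1.subset sdiff_subset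
  have hdisj : ∀ i j, i ≠ j → Disjoint (D i) (D j) := by
    intro i j hij
    rw [disjoint_left]
    intro e hei hej
    have heU : e ∈ U := hWU i j hij (mem_inter.2 ⟨(mem_sdiff.1 hei).1, (mem_sdiff.1 hej).1⟩)
    exact (mem_sdiff.1 hei).2 heU
  obtain ⟨Ds, hlen, hF, hmem⟩ := exists_fresh_list D hD hdisj hs hqr q le_rfl
  have hDs : ∀ D' ∈ Ds, IsMatching D' ∧ D'.Nonempty ∧ #D' ≤ s := fun D' hD' => by
    obtain ⟨i, rfl⟩ := hmem D' hD'
    exact ⟨hDmatch i, hD i⟩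
  have hbound := card_filter_forall_not_subset_mul_le Ds hF hDs
  rw [hlen] at hbound
  refine le_trans (Nat.mul_le_mul_right _ (card_le_card fun h hh => ?_)) hbound
  obtain ⟨-, hU, hWi⟩ := mem_filter.1 hh
  refine mem_filter.2 ⟨mem_univ _, fun D' hD' hsub => ?_⟩
  obtain ⟨i, rfl⟩ := hmem D' hD'
  refine hWi i fun e he => ?_
  by_cases heU : e ∈ U
  · exact hU heU
  · exact hsub (mem_sdiff.2 ⟨he, heU⟩)

/-- **Jukna 2012, Lemma 9.37, counting form.** For `𝒜 ⊆ Per_s` and `(s q)² ≤ r`, the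
colourings accepted by `⌈𝒜*⌉` but not by `⌈𝒜⌉` (`𝒜*` the `r`-closure in `Per_s`) number at
most `|Per_s ∖ 𝒜| · ⌊(2ˢ - 1)^q 4^m / (2ˢ)^q⌋ ≤ |Per_s| · (1 - 2^{-s})^q · 4^m`: the closure is
reached by at most `|Per_s|` steps `𝒜_i ↦ 𝒜_i ∪ {E_i}`, `𝒜_i ⊢ E_i`, each costing at most
(9.8). At a join `𝒜 = 𝒜₁ ∪ 𝒜₂` this bounds `Prob[E₋ ∈ δ₋(M₁, M₂)]`. [cite: Jukna2012, Lemma 9.37] -/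
theorem card_negErr_le {r s q : ℕ} (hs : 0 < s) (hqr : (s * q) ^ 2 ≤ r) {A : Finset (Finset (Edge m))}
    (hA : A ⊆ Per m s) :
    #(univ.filter fun h : Vtx m → Bool =>
        Accepts (closureIn r (Per m s) A) (colorGraph h) ∧ ¬ Accepts A (colorGraph h)) ≤
      #(Per m s \ A) * ((2 ^ s - 1) ^ q * 4 ^ m / (2 ^ s) ^ q) := by
  classical
  have h := card_filter_closureIn_gain_le (r := r) (P := Per m s) (univ : Finset (Vtx m → Bool))
    (fun E h => E ⊆ colorGraph h) (ε := (2 ^ s - 1) ^ q * 4 ^ m / (2 ^ s) ^ q) ?_ hA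
  · exact h
  · intro A' _ F hF W hW hWF
    rw [Nat.le_div_iff_mul_le (pow_pos (pow_pos two_pos s) q)]
    exact card_stepErr_mul_le hs hqr W (fun i => ‹A' ⊆ Per m s› (hW i)) hWF

/-- **The negative error of the scheme**, in the form consumed by
`ApproxScheme.exists_approx_circuit` (unit weights on the `4^m` colourings): an approximate OR
wrongly accepts at most `|Per_s| · ⌊(2ˢ - 1)^q 4^m / (2ˢ)^q⌋` colourings.
[cite: Jukna2012, Lemma 9.37] -/
theorem sum_gainedSup_le {r s q : ℕ} (hr : 2 ≤ r) (hs : 1 ≤ s) (hqr : (s * q) ^ 2 ≤ r)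
    {A B : Finset (Finset (Edge m))} (hA : (scheme m r s hr hs).ok A) (hB : (scheme m r s hr hs).ok B) :
    ∑ _h ∈ (scheme m r s hr hs).gainedSup univ colorInput A B, (1 : ℝ) ≤
      ((#(Per m s) * ((2 ^ s - 1) ^ q * 4 ^ m / (2 ^ s) ^ q) : ℕ) : ℝ) := by
  classical
  rw [sum_const, nsmul_eq_mul, mul_one]
  have hsub : A ∪ B ⊆ Per m s := union_subset hA.subset hB.subset
  have h := card_negErr_le (q := q) hs hqr hsub
  refine le_trans ?_ (Nat.cast_le.2 (h.trans (Nat.mul_le_mul_right _ (card_le_card sdiff_subset))))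
  refine Nat.cast_le.2 (card_le_card fun h hh => ?_)
  obtain ⟨-, hab, hsup⟩ := mem_filter.1 hh
  refine mem_filter.2 ⟨mem_univ _, ?_, fun hacc => ?_⟩
  · have := (scheme_val_eq_true_iff hr hs _ _).1 hsup
    rwa [edgesOf_colorInput] at this
  · rw [Bool.or_eq_false_iff] at hab
    rcases accepts_union_iff.1 hacc with h' | h'
    · have : (scheme m r s hr hs).val A (colorInput h) = true := by
        rw [scheme_val_eq_true_iff, edgesOf_colorInput]; exact h'
      rw [this] at hab
      exact Bool.noConfusion hab.1
    · have : (scheme m r s hr hs).val B (colorInput h) = true := by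
        rw [scheme_val_eq_true_iff, edgesOf_colorInput]; exact h'
      rw [this] at hab
      exact Bool.noConfusion hab.2

/-- **A single matching is monochromatic with probability `2^{-|E|}`** (Jukna 2012, Lemma 9.35
for a matching, used in Case 2 of Thm. 9.38: "`Prob[E₋ ∈ ⌈E⌉] = 2^{-|E|} ≥ 2^{-s}`"):
`#{h : E ⊆ E₋(h)} · 2^{|E|} = 4^m`. [cite: Jukna2012, Lemma 9.35 and Thm. 9.38] -/
theorem card_filter_subset_colorGraph_mul {E : Finset (Edge m)} (hE : IsMatching E) :
    #(univ.filter fun h : Vtx m → Bool => E ⊆ colorGraph h) * 2 ^ #E = 4 ^ m := by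
  classical
  have h := card_filter_block_mul (E := ∅) hE (fun e _ => Or.inl (by simp [everts]))
    (univ : Finset (Vtx m → Bool)) (fun w _ h _ => mem_univ _)
  rwa [card_univ, card_colorings] at h

end PerfectMatching

end Literature.Computability.Complexity
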